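import Summits.HodgeConjecture.HodgeCM.Model.ArchKTypeOfHarm_1

/-! PORT of `HodgeCM/Model/ArchKTypeOfHarm.lean` (HodgeCMPerL run 82) — part 2: continuation of `Summits.HodgeConjecture.HodgeCM.Model.ArchKTypeOfHarm_1` (split at a top-level declaration boundary by port_pkg.py; scope re-opened below; declarations unchanged). -/

-- port_pkg: scope re-opened for this part (file-level context, then the namespace/section stack open at the cut)
set_option autoImplicit false
noncomputable section
open NumberField NumberField.InfinitePlace NumberField.mixedEmbedding IsDedekindDomain MeasureTheory
open scoped Matrix TensorProduct Classical SchwartzMap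
open MulAction
open Literature.Geometry.ComplexHyperbolic.BallModel (U21 x₀ stabilizerEquivK21)
open Literature.NumberTheory.Automorphic.U21 (K21 matA sclD pPlus pPlus_apply)
open Literature.AlgebraicGeometry.ShimuraVarieties.BallForms (isPullbackCocycle_cotangentCocycle weightOf_cotangent_dual_apply)
open Literature.NumberTheory.Automorphic Literature.NumberTheory.Weil1964
open Literature.RepresentationTheory.KonnoKonno2007 Literature.RepresentationTheory.KonnoKonno2007.RealDualPair
open Literature.NumberTheory.GelbartRogawski1991 Literature.NumberTheory.GelbartRogawski1991.UnitaryDualPair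
open Literature.Analysis.SegalBargmann
open HodgeCM.Adelic HodgeCM.PerL34 HodgeCM.Model.HypCensus
namespace HodgeCM.Model
namespace ArchSideTerm
variable {L : CMField} {ι₁ : L →+* ℂ} (V : HermSpace3 L ι₁) (S : StubTree.SeesawDatum L)
variable
  (hGR : (cmSplittingDatum (L : Type) finProdFinEquiv (frameD V) (frameD_real V) (frameD_ne V) (dW S) (dW_real S) (dW_ne S)).CompatibleSplitting)
  (hGR₀ : (cmSplittingDatum (L : Type) (e₁) (frameD V) (frameD_real V) (frameD_ne V) (lineVec (L : Type) (dW S 0))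
    (fun _ => dW_real S 0) (fun _ => dW_ne S 0)).CompatibleSplitting)
  (hGR₁ : (cmSplittingDatum (L : Type) (e₁) (frameD V) (frameD_real V) (frameD_ne V) (lineVec (L : Type) (dW S 1))
    (fun _ => dW_real S 1) (fun _ => dW_ne S 1)).CompatibleSplitting)
  (hGR₂ : (cmSplittingDatum (L : Type) (e₁) (frameD V) (frameD_real V) (frameD_ne V) (lineVec (L : Type) (dW' S 0))
    (fun _ => dW'_real S 0) (fun _ => dW'_ne S 0)).CompatibleSplitting)
  (hGR₃ : (cmSplittingDatum (L : Type) (e₁) (frameD V) (frameD_real V) (frameD_ne V) (lineVec (L : Type) (dW' S 1))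
    (fun _ => dW'_real S 1) (fun _ => dW'_ne S 1)).CompatibleSplitting)
  (η₀ η₁ η₂ η₃ : CMAdelic (L : Type) (frameD V) × CMAdelicOne (L : Type) →* ℂˣ)
/-- **(W-K∞′) `harm` of row 12 for line 2** — literally the `harm` hypothesis of
`archKTypeOf … (lineOmega_two V S hGR hGR₂ hGR₃ η₂) … (blockFamilyOf (L:Type) e₁ (frameD V) … (lineVec (dW' S 0)) … ι₁ (blockPosEquiv V)
(blockNegEquiv V) Φ₁ Φ₂) …`, from (F) the frame matching on `Stab(x₀)`, (K) the pin's vacuum character `ev` at `v₁` for line 2,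
(Φ) the `μ₀`-type of `Φ₁`, (χ) `c_2(u) · det A(u)^{e_P} · d(u)^{e_Q} = d̄(u)`. -/
theorem lineOmega_two_harm
    (Φ₁ : Module.Dual ℂ (Fin 2 → ℂ) →ₗ[ℂ]
      SchwartzMap (DPIdx (Fin 2) Unit
        (PosIdx (cmXW (L : Type) (frameD V) (lineVec (L : Type) (dW' S 0)) (fun _ => dW'_real S 0) ι₁ (cmPlace (L : Type) ι₁)))
        (NegIdx (cmXW (L : Type) (frameD V) (lineVec (L : Type) (dW' S 0)) (fun _ => dW'_real S 0) ι₁ (cmPlace (L : Type) ι₁))) → ℝ) ℂ)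
    (Φ₂ : SchwartzMap ((Fin 3 × {v : {v : InfinitePlace ↥(maximalRealSubfield L) // v.IsReal} // v ≠ cmPlace (L : Type) ι₁}) → ℝ) ℂ)
    (hsec : ∀ u : stabilizer U21 x₀,
      cmBlockSection (L : Type) (frameD V) (frameD_real V) (frameD_ne V) (lineVec (L : Type) (dW' S 0)) (fun _ => dW'_real S 0)
          (fun _ => dW'_ne S 0) ι₁ (blockPosEquiv V) (blockNegEquiv V) (u21FrameEquiv (u : U21), 1) = (archSectionFrameOf V u, 1))
    {ev : VacExponents}
    (hK : ∀ (kk : DPK (Fin 2) Unit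
        (PosIdx (cmXW (L : Type) (frameD V) (lineVec (L : Type) (dW' S 0)) (fun _ => dW'_real S 0) ι₁ (cmPlace (L : Type) ι₁)))
        (NegIdx (cmXW (L : Type) (frameD V) (lineVec (L : Type) (dW' S 0)) (fun _ => dW'_real S 0) ι₁ (cmPlace (L : Type) ι₁))))
      (Φ : SchwartzMap (DPIdx (Fin 2) Unit
        (PosIdx (cmXW (L : Type) (frameD V) (lineVec (L : Type) (dW' S 0)) (fun _ => dW'_real S 0) ι₁ (cmPlace (L : Type) ι₁)))
        (NegIdx (cmXW (L : Type) (frameD V) (lineVec (L : Type) (dW' S 0)) (fun _ => dW'_real S 0) ι₁ (cmPlace (L : Type) ι₁))) → ℝ) ℂ),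
      cmBlockRep (L : Type) e₁ (frameD V) (frameD_real V) (frameD_ne V) (lineVec (L : Type) (dW' S 0)) (fun _ => dW'_real S 0)
          (fun _ => dW'_ne S 0) hGR₂ ι₁ (blockPosEquiv V) (blockNegEquiv V)
          (cmBlockSection (L : Type) (frameD V) (frameD_real V) (frameD_ne V) (lineVec (L : Type) (dW' S 0)) (fun _ => dW'_real S 0)
            (fun _ => dW'_ne S 0) ι₁ (blockPosEquiv V) (blockNegEquiv V) (κ _ _ _ _ kk)) (tensorPi Φ Φ₂) =
        tensorPi (κOp _ _ ev kk Φ) Φ₂)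
    (hΦ₁ : ∀ (kV : Matrix.unitaryGroup (Fin 2) ℂ × Matrix.unitaryGroup Unit ℂ) (b : Fin 2 → ℂ),
      unitaryOpPi (dualPairι ((kV, 1) : DPK (Fin 2) Unit
          (PosIdx (cmXW (L : Type) (frameD V) (lineVec (L : Type) (dW' S 0)) (fun _ => dW'_real S 0) ι₁ (cmPlace (L : Type) ι₁)))
          (NegIdx (cmXW (L : Type) (frameD V) (lineVec (L : Type) (dW' S 0)) (fun _ => dW'_real S 0) ι₁ (cmPlace (L : Type) ι₁)))))
          (Φ₁ (dotProductEquiv ℂ (Fin 2) b)) =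
        Φ₁ (dotProductEquiv ℂ (Fin 2) ((kV.1 : Matrix (Fin 2) (Fin 2) ℂ) *ᵥ b)))
    (hχ : ∀ u : stabilizer U21 x₀,
      ((lineScalar_two V S hGR hGR₂ hGR₃ η₂ (u : U21) : ℂˣ) : ℂ) *
          ((matA (stabilizerEquivK21.symm u)).det ^ ev.eP * sclD (stabilizerEquivK21.symm u) ^ ev.eQ) =
        star (sclD (stabilizerEquivK21.symm u)))
    (u : stabilizer U21 x₀) (ℓ : Module.Dual ℂ (Fin 2 → ℂ)) :
    lineOmega_two V S hGR hGR₂ hGR₃ η₂ (u : U21)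
        (blockFamilyOf (L : Type) e₁ (frameD V) (frameD_real V) (frameD_ne V) (lineVec (L : Type) (dW' S 0)) (fun _ => dW'_real S 0)
          (fun _ => dW'_ne S 0) ι₁ (blockPosEquiv V) (blockNegEquiv V) Φ₁ Φ₂ ℓ) =
      blockFamilyOf (L : Type) e₁ (frameD V) (frameD_real V) (frameD_ne V) (lineVec (L : Type) (dW' S 0)) (fun _ => dW'_real S 0)
          (fun _ => dW'_ne S 0) ι₁ (blockPosEquiv V) (blockNegEquiv V) Φ₁ Φ₂
        ((isPullbackCocycle_cotangentCocycle.weightOf x₀).dual u ℓ) :=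
  smulPull_blockFamilyOf_harm V e₁ (lineVec (L : Type) (dW' S 0)) (fun _ => dW'_real S 0) (fun _ => dW'_ne S 0) hGR₂
    (lineScalar_two V S hGR hGR₂ hGR₃ η₂) Φ₁ Φ₂ hsec hK hΦ₁ hχ u ℓ

/-- **(W-K∞′) `harm` of row 12 for line 3** — literally the `harm` hypothesis of
`archKTypeOf … (lineOmega_three V S hGR hGR₂ hGR₃ η₃) … (blockFamilyOf (L:Type) e₁ (frameD V) … (lineVec (dW' S 1)) … ι₁ (blockPosEquiv V)
(blockNegEquiv V) Φ₁ Φ₂) …`, from (F) the frame matching on `Stab(x₀)`, (K) the pin's vacuum character `ev` at `v₁` for line 3,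
(Φ) the `μ₀`-type of `Φ₁`, (χ) `c_3(u) · det A(u)^{e_P} · d(u)^{e_Q} = d̄(u)`. -/
theorem lineOmega_three_harm
    (Φ₁ : Module.Dual ℂ (Fin 2 → ℂ) →ₗ[ℂ]
      SchwartzMap (DPIdx (Fin 2) Unit
        (PosIdx (cmXW (L : Type) (frameD V) (lineVec (L : Type) (dW' S 1)) (fun _ => dW'_real S 1) ι₁ (cmPlace (L : Type) ι₁)))
        (NegIdx (cmXW (L : Type) (frameD V) (lineVec (L : Type) (dW' S 1)) (fun _ => dW'_real S 1) ι₁ (cmPlace (L : Type) ι₁))) → ℝ) ℂ)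
    (Φ₂ : SchwartzMap ((Fin 3 × {v : {v : InfinitePlace ↥(maximalRealSubfield L) // v.IsReal} // v ≠ cmPlace (L : Type) ι₁}) → ℝ) ℂ)
    (hsec : ∀ u : stabilizer U21 x₀,
      cmBlockSection (L : Type) (frameD V) (frameD_real V) (frameD_ne V) (lineVec (L : Type) (dW' S 1)) (fun _ => dW'_real S 1)
          (fun _ => dW'_ne S 1) ι₁ (blockPosEquiv V) (blockNegEquiv V) (u21FrameEquiv (u : U21), 1) = (archSectionFrameOf V u, 1))
    {ev : VacExponents}
    (hK : ∀ (kk : DPK (Fin 2) Unit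
        (PosIdx (cmXW (L : Type) (frameD V) (lineVec (L : Type) (dW' S 1)) (fun _ => dW'_real S 1) ι₁ (cmPlace (L : Type) ι₁)))
        (NegIdx (cmXW (L : Type) (frameD V) (lineVec (L : Type) (dW' S 1)) (fun _ => dW'_real S 1) ι₁ (cmPlace (L : Type) ι₁))))
      (Φ : SchwartzMap (DPIdx (Fin 2) Unit
        (PosIdx (cmXW (L : Type) (frameD V) (lineVec (L : Type) (dW' S 1)) (fun _ => dW'_real S 1) ι₁ (cmPlace (L : Type) ι₁)))
        (NegIdx (cmXW (L : Type) (frameD V) (lineVec (L : Type) (dW' S 1)) (fun _ => dW'_real S 1) ι₁ (cmPlace (L : Type) ι₁))) → ℝ) ℂ),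
      cmBlockRep (L : Type) e₁ (frameD V) (frameD_real V) (frameD_ne V) (lineVec (L : Type) (dW' S 1)) (fun _ => dW'_real S 1)
          (fun _ => dW'_ne S 1) hGR₃ ι₁ (blockPosEquiv V) (blockNegEquiv V)
          (cmBlockSection (L : Type) (frameD V) (frameD_real V) (frameD_ne V) (lineVec (L : Type) (dW' S 1)) (fun _ => dW'_real S 1)
            (fun _ => dW'_ne S 1) ι₁ (blockPosEquiv V) (blockNegEquiv V) (κ _ _ _ _ kk)) (tensorPi Φ Φ₂) =
        tensorPi (κOp _ _ ev kk Φ) Φ₂)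
    (hΦ₁ : ∀ (kV : Matrix.unitaryGroup (Fin 2) ℂ × Matrix.unitaryGroup Unit ℂ) (b : Fin 2 → ℂ),
      unitaryOpPi (dualPairι ((kV, 1) : DPK (Fin 2) Unit
          (PosIdx (cmXW (L : Type) (frameD V) (lineVec (L : Type) (dW' S 1)) (fun _ => dW'_real S 1) ι₁ (cmPlace (L : Type) ι₁)))
          (NegIdx (cmXW (L : Type) (frameD V) (lineVec (L : Type) (dW' S 1)) (fun _ => dW'_real S 1) ι₁ (cmPlace (L : Type) ι₁)))))
          (Φ₁ (dotProductEquiv ℂ (Fin 2) b)) =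
        Φ₁ (dotProductEquiv ℂ (Fin 2) ((kV.1 : Matrix (Fin 2) (Fin 2) ℂ) *ᵥ b)))
    (hχ : ∀ u : stabilizer U21 x₀,
      ((lineScalar_three V S hGR hGR₂ hGR₃ η₃ (u : U21) : ℂˣ) : ℂ) *
          ((matA (stabilizerEquivK21.symm u)).det ^ ev.eP * sclD (stabilizerEquivK21.symm u) ^ ev.eQ) =
        star (sclD (stabilizerEquivK21.symm u)))
    (u : stabilizer U21 x₀) (ℓ : Module.Dual ℂ (Fin 2 → ℂ)) :
    lineOmega_three V S hGR hGR₂ hGR₃ η₃ (u : U21)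
        (blockFamilyOf (L : Type) e₁ (frameD V) (frameD_real V) (frameD_ne V) (lineVec (L : Type) (dW' S 1)) (fun _ => dW'_real S 1)
          (fun _ => dW'_ne S 1) ι₁ (blockPosEquiv V) (blockNegEquiv V) Φ₁ Φ₂ ℓ) =
      blockFamilyOf (L : Type) e₁ (frameD V) (frameD_real V) (frameD_ne V) (lineVec (L : Type) (dW' S 1)) (fun _ => dW'_real S 1)
          (fun _ => dW'_ne S 1) ι₁ (blockPosEquiv V) (blockNegEquiv V) Φ₁ Φ₂
        ((isPullbackCocycle_cotangentCocycle.weightOf x₀).dual u ℓ) :=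
  smulPull_blockFamilyOf_harm V e₁ (lineVec (L : Type) (dW' S 1)) (fun _ => dW'_real S 1) (fun _ => dW'_ne S 1) hGR₃
    (lineScalar_three V S hGR hGR₂ hGR₃ η₃) Φ₁ Φ₂ hsec hK hΦ₁ hχ u ℓ

end ArchSideTerm

end HodgeCM.Model

end
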